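import Summits.HodgeConjecture.HodgeConjecture.Theorems.CurveNetMordellWeilVerticalSupportMiddleReduction
import Summits.HodgeConjecture.HodgeConjecture.Theorems.CurveNetMordellWeilVerticalSupportMiddleChowDegenerate
import Summits.HodgeConjecture.HodgeConjecture.Theorems.LinearSystemTorelliTranscendentalOrSupportedStubOfMiddleOfHodgeEffectiveAbstract

/-!
# Route LinearSystemTorelli — the weakest obligation of a line on `MiddleDivisorSupport` (stmt-HodgeConjecture-1081)

The funnel item `MiddleDivisorSupport` (stmt-HodgeConjecture-1081; every rational `(p,p)`-class in the
middle degree of a smooth projective `2p`-fold, `p ≥ 1`, lies in `N¹ H²ᵖ = supportedClasses X (2p) 1`)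
is, as typed, equivalent to the Hodge conjecture (`middleDivisorSupport_iff_hodgeConjecture`, landed).
This file records, for the leads of future lines on the item, the WEAKEST statement a line has to
prove — the crux with the dimension induction made internal and the conclusion kept at divisor
support:

* `linearSystemTorelli_middleDivisorSupport_iff_middleSupportStep` — the crux holds iff, for every
  `q ≥ 2` and every smooth projective `2q`-fold `X`, GRANTED the Hodge conjecture for all smooth
  projective varieties of dimension `< 2q` (`RegimeSplit.HodgeBelowDim (2q)`), every rational
  `(q,q)`-class of `X` is supported on a divisor. (`p = 1` is Lefschetz (1,1) and never has to be
  treated; below / above the middle the tree's pencil step and hard Lefschetz apply; a supported Hodge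
  class is algebraic under the induction hypothesis by Deligne 8.2.8 + Voisin's Gysin lift, both
  discharged in the tree — `supportedHodgeClasses_algebraic_of_hodgeBelowDim`.)
* `linearSystemTorelli_middleDivisorSupport_iff_heartSupportStep_of_gysin` — granted a Gysin /
  cycle-class formalism with Hodge-compatible Gysin morphisms (the tree's hypothesis structure
  `GysinFormalism` with `IsGysinHodgeCompatible`, under which the CH₀-degenerate regime of the middle
  step is LANDED: `middleStepChowDegenerate_of_gysin`, Bloch–Srinivas / Voisin II Prop. 10.26), the
  crux holds iff the same support statement holds on the CH₀-NON-degenerate `2q`-folds only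
  (`¬ RegimeSplit.ChowZeroDegenerate X`: the heart, `⊇ {h^{2q,0} ≠ 0}` by Mumford–Roitman).

Pure composition of landed theorems of the sibling crux `VerticalSupportMiddle`
(stmt-HodgeConjecture-2782, line `regime-split-middle-step`): `middleStepFor_of_coniveau`,
`middleStep_of_regimes`, `hodgeConjecture_of_middleStep`, `middleStepChowDegenerate_of_gysin`, and of
this route's `middleDivisorSupport_of_hodgeConjecture`. No named fact, no definition.

References: R. Thomas, Nodes and the Hodge conjecture, J. Algebraic Geom. 14 (2005), Thm. 1 and
Prop. 2; C. Voisin, Hodge Theory and Complex Algebraic Geometry II (2003), Cor. 10.21, Thm. 10.17,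
Prop. 10.26; M. Kerr, G. Pearlstein (2011), §3.1.
-/

-- `Summit.HodgeConjecture.HodgeConjecture.Theorems` is the mandated namespace (single-conjunct summit:
-- Sub = Summit), which `linter.dupNamespace` flags on every declaration; the lakefile turns the
-- linter off tree-wide (weak option), restated here so stand-alone elaboration is warning-free too.
set_option linter.dupNamespace false

noncomputable section

namespace Summit.HodgeConjecture.HodgeConjecture.Theorems

open Literature.AlgebraicGeometry.Motives Literature.AlgebraicGeometry.HodgeTheory
open RegimeSplit

/-- **The middle SUPPORT step implies the middle step** (on any class `P` of `2q`-folds): if, for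
`q ≥ 2` and `X` smooth projective of dimension `2q` with `P X`, the Hodge conjecture below dimension
`2q` puts every rational `(q,q)`-class of `X` on a divisor, then it makes every such class algebraic
— a supported rational Hodge class is algebraic under the induction hypothesis
(`supportedHodgeClasses_algebraic_of_hodgeBelowDim`, through `middleStepFor_of_coniveau`).
[cite: DeligneHodgeIII1974, Cor. 8.2.8] [cite: Voisin2025, Cor. 2.12] -/
theorem linearSystemTorelli_middleStepFor_of_supportStep (P : ∀ _ : SchemeOver ℂ, Prop)
    (h : ∀ ⦃q : ℕ⦄ ⦃X : SchemeOver ℂ⦄, 2 ≤ q → IsSmoothProjective (2 * q) X → HodgeBelowDim (2 * q) →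
      P X → ∀ c : complexBetti X (2 * q), IsRationalClass c → IsOfHodgeType (2 * q) X (2 * q) q q c →
        c ∈ supportedClasses X (2 * q) 1) :
    MiddleStepFor P := by
  refine middleStepFor_of_coniveau P fun q X hq hX ih hP ↦ ?_
  refine le_trans (Submodule.span_mono ?_) le_sup_right
  rintro c ⟨hc, hh⟩
  exact ⟨hc, hh, h hq hX ih hP c hc hh⟩

/-- **The weakest obligation of a line on `MiddleDivisorSupport` (stmt-HodgeConjecture-1081).** The
crux holds iff for every `q ≥ 2` and every smooth projective complex `2q`-fold `X`, GRANTED the Hodge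
conjecture for all smooth projective varieties of dimension `< 2q` (`RegimeSplit.HodgeBelowDim (2q)`),
every rational `(q,q)`-class in `H^{2q}(X(ℂ); ℂ)` is supported on a divisor
(`∈ supportedClasses X (2q) 1`). (`→`: drop the extra hypotheses; `←`: the support step gives the
middle step (`linearSystemTorelli_middleStepFor_of_supportStep`), the middle step gives the Hodge
conjecture level-wise (`hodgeConjecture_of_middleStep`: `p = 0` trivial, `p = 1` in the middle is
Lefschetz (1,1), pencils below and hard Lefschetz above the middle), and the Hodge conjecture gives
the crux (`middleDivisorSupport_of_hodgeConjecture`).)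
[cite: Thomas2005Nodes, Thm. 1 and Prop. 2] [cite: KerrPearlstein2011, §3.1] -/
theorem linearSystemTorelli_middleDivisorSupport_iff_middleSupportStep :
    Summit.HodgeConjecture.HodgeConjecture.Theses.LinearSystemTorelli.MiddleDivisorSupport ↔
      ∀ ⦃q : ℕ⦄ ⦃X : SchemeOver ℂ⦄, 2 ≤ q → IsSmoothProjective (2 * q) X → HodgeBelowDim (2 * q) →
        ∀ c : complexBetti X (2 * q), IsRationalClass c → IsOfHodgeType (2 * q) X (2 * q) q q c →
          c ∈ supportedClasses X (2 * q) 1 := by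
  constructor
  · intro hMid q X hq hX _ c hc hh
    exact hMid (show 1 ≤ q by omega) hX c hc hh
  · intro h
    exact middleDivisorSupport_of_hodgeConjecture (hodgeConjecture_of_middleStep
      (linearSystemTorelli_middleStepFor_of_supportStep (fun _ ↦ True)
        fun q X hq hX ih _ c hc hh ↦ h hq hX ih c hc hh))

/-- **The heart suffices, granted a Gysin / cycle-class formalism.** Granted `G : GysinFormalism`
with Hodge-compatible Gysin morphisms (under which the CH₀-degenerate regime of the middle step is
the landed `middleStepChowDegenerate_of_gysin` — Bloch–Srinivas decomposition of the diagonal,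
Voisin II Prop. 10.26), the crux `MiddleDivisorSupport` holds iff for every `q ≥ 2` and every smooth
projective `2q`-fold `X` whose `CH₀` is NOT degenerate (`¬ RegimeSplit.ChowZeroDegenerate X`; this
class contains every `X` with `h^{2q,0} ≠ 0`, Mumford–Roitman), granted the Hodge conjecture below
dimension `2q`, every rational `(q,q)`-class of `X` is supported on a divisor.
[cite: VoisinHodgeII2003, Cor. 10.21, Thm. 10.17 and Prop. 10.26] [cite: Thomas2005Nodes, Thm. 1] -/
theorem linearSystemTorelli_middleDivisorSupport_iff_heartSupportStep_of_gysin (G : GysinFormalism)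
    (hG : G.IsGysinHodgeCompatible) :
    Summit.HodgeConjecture.HodgeConjecture.Theses.LinearSystemTorelli.MiddleDivisorSupport ↔
      ∀ ⦃q : ℕ⦄ ⦃X : SchemeOver ℂ⦄, 2 ≤ q → IsSmoothProjective (2 * q) X → HodgeBelowDim (2 * q) →
        ¬ ChowZeroDegenerate X →
        ∀ c : complexBetti X (2 * q), IsRationalClass c → IsOfHodgeType (2 * q) X (2 * q) q q c →
          c ∈ supportedClasses X (2 * q) 1 := by
  constructor
  · intro hMid q X hq hX _ _ c hc hh
    exact hMid (show 1 ≤ q by omega) hX c hc hh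
  · intro h
    exact middleDivisorSupport_of_hodgeConjecture (hodgeConjecture_of_middleStep
      (middleStep_of_regimes (middleStepChowDegenerate_of_gysin G hG)
        (linearSystemTorelli_middleStepFor_of_supportStep (fun X ↦ ¬ ChowZeroDegenerate X) h)))

end Summit.HodgeConjecture.HodgeConjecture.Theorems

end
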